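import Summits.PneNP.PneNP.Theorems.CliqueExtLowerBound.Negative.Padding
import Summits.PneNP.PneNP.Theorems.CliqueExtLowerBound.Negative.PermConsequences
import Summits.PneNP.PneNP.Theorems.ConvexRankGatesLinAlgGateBlindDetNormalForm
import Summits.PneNP.PneNP.Theorems.Capture.Negative.BoundedFanIn

/-!
# PneNP / ConvexRankGates — `MixedBasisSynthesis` (stmt-PneNP-14728): narrow cross-door gates are absorbed

The glue item `MixedBasisSynthesis : ConvexGateBlind → LinAlgGateBlind → CliqueExtLowerBound` (route
`ConvexRankGates`, rev 6) asks that blindness of the convex door (`{∧₂,∨₂} ∪ CONV_{m^c}`, crux #2) and of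
the algebraic door (`{∧₂,∨₂} ∪ PERM_{m^c} ∪ GRANK_{m^c}`, crux #4) upgrade to the mixed basis `B_{m^c}`.
Its content is the possible SYNERGY of the two doors inside one circuit. This `--supports` file proves,
sorry-free, how much synergy is excluded for free: **each door alone already defeats every mixed circuit
whose gates from the OTHER door have fan-in `≤ c·log₂ m`** — indeed whose other gates are ANY monotone
gates `g` with `2^{fan-in g} ≤ m^c`. So a counterexample to the glue item (poly-size mixed circuits for
`CLIQUE(m, ⌈m^δ⌉₊)` while both pure doors stay blind) must interleave CONV gates of fan-in `> c·log₂ m`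
with PERM/GRANK gates of fan-in `> c·log₂ m`, for every `c`.

* `LowerBoundAtOver.absorb_narrow` — generic: for a basis family monotone in the size parameter and
  containing `{∧₂,∨₂,0,1}` from level 1, hardness at a schedule `k` survives ENLARGING level `s` by all
  monotone gates `g` with `2^{g.1} ≤ s`. Proof = gate-by-gate rebasing (`Capture.Negative.Circuit.rebase`)
  with monotone Shannon expansion as the gadget (`Capture.Negative.cktSize_of_monotone_gate`,
  `monoBound k + 2 ≤ 3·2^k`): size `≤ 1 + 3 m^c · m^c ≤ m^{2c+3}`, exponent `c ↦ 2c + 3`.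
* `monotoneBasis01_subset_convFamily` / `monotoneBasis01_subset_linFamily` — the constants are CONV gates
  of width `≤ 1` (`isConvGate_one_constFalse`, `isConvGate_constTrue`) and GRANK gates of dimension `0`
  (`isGRankGate_constTrue`, `isGRankGate_of_forall_eq_false`).
* `convexGateBlind_absorbs_narrow`, `linAlgGateBlind_absorbs_narrow` — cruxes #2 / #4 in the enlarged
  families; `convexGateBlind_mixed_of_narrow_algebraic`, `linAlgGateBlind_mixed_of_narrow_convex` — the
  same read on `B_{m^c}`-circuits (`extGate`, all of whose gates are monotone): the glue item restricted to
  circuits whose PERM/GRANK gates (resp. CONV gates) proper are narrow holds from #2 (resp. #4) alone.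

Not here: anything about WIDE gates of both doors in one circuit — that is the item itself (see the
sibling file `ConvexRankGatesMixedBasisSynthesisGlue.lean`: equivalence `#5 ↔ #2 ∧ #4`, common `δ`,
pure-door case, door-separation normal form). Fan-in, not width: compare the engine-side notion of narrow
algebraic gates by WIDTH `≤ m^{1/16}` in `ConvexRankGatesCliqueExtLowerBoundStubNarrowAlgebraic.lean`.
-/

namespace Summit.PneNP.PneNP.Theorems

open Filter Literature.Computability.Complexity
open Summit.PneNP.PneNP.Theses.ConvexRankGates (CliqueExtLowerBound LinAlgGateBlind ConvexGateBlind)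
open Summit.PneNP.PneNP.Theorems.CliqueExtLowerBound.Negative
open Summit.PneNP.PneNP.Theorems.Capture.Negative (monoBound cktSize_of_monotone_gate
  const_mem_monotoneBasis01)

/-! ## §4 Narrow cross-door gates are absorbed: synergy needs wide fan-in on both sides -/

section Narrow

/-- `monoBound k + 2 ≤ 3 · 2^k` (so the monotone Shannon expansion of a `k`-ary gate has `< 3·2^k`
gates). [folklore] -/
theorem monoBound_add_two_le (k : ℕ) : monoBound k + 2 ≤ 3 * 2 ^ k := by
  induction k with
  | zero => simp [monoBound]
  | succ k ih => simp only [monoBound, pow_succ]; omega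

/-- Size bookkeeping for rebasing: `1 + 3 m^c · m^c ≤ m^{2c+3}` for `m ≥ 2`. [folklore] -/
theorem one_add_three_mul_pow_le {m c : ℕ} (hm : 2 ≤ m) : 1 + 3 * m ^ c * m ^ c ≤ m ^ (2 * c + 3) := by
  have h1 : 1 ≤ m ^ (2 * c) := Nat.one_le_pow _ _ (by omega)
  have h4 : 4 ≤ m ^ 2 := by nlinarith
  calc 1 + 3 * m ^ c * m ^ c = 1 + 3 * m ^ (2 * c) := by ring
    _ ≤ 4 * m ^ (2 * c) := by omega
    _ ≤ m ^ 2 * m ^ (2 * c) := Nat.mul_le_mul_right _ h4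
    _ = m ^ (2 * c + 2) := by ring
    _ ≤ m ^ (2 * c + 3) := Nat.pow_le_pow_right (by omega) (by omega)

/-- **Absorption of narrow gates (generic basis family).** Let `basis : ℕ → Set GateFn` be monotone in
the size parameter and contain `{∧₂, ∨₂, 0, 1}` from level `1` on. Hardness over `basis` at a schedule `k`
implies hardness over the family ENLARGED, at level `s`, by ALL monotone gates `g` with `2^{fan-in g} ≤ s`
(at level `s = m^c`: every monotone gate of fan-in `≤ c·log₂ m`, whatever its class). Proof: rebase gate
by gate (`Capture.Negative.Circuit.rebase`) — a basis gate is its own 1-gate gadget, a narrow gate has a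
`{∧₂,∨₂,0,1}`-gadget with `monoBound (fan-in) ≤ 3·2^{fan-in} ≤ 3 m^c` gates by monotone Shannon expansion
(`Capture.Negative.cktSize_of_monotone_gate`); the rebased circuit has `≤ 1 + 3 m^c · m^c ≤ m^{2c+3}`
gates over `basis (m^c) ⊆ basis (m^{2c+3})` and computes the same function. [folklore] -/
theorem LowerBoundAtOver.absorb_narrow {basis : ℕ → Set GateFn} (hmono : Monotone basis)
    (h01 : ∀ s, 1 ≤ s → monotoneBasis01 ⊆ basis s) {k : ℕ → ℕ} (h : LowerBoundAtOver basis k) :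
    LowerBoundAtOver (fun s => basis s ∪ {g | Monotone g.2 ∧ 2 ^ g.1 ≤ s}) k := by
  intro c
  filter_upwards [h (2 * c + 3), eventually_ge_atTop 2] with m hm h2 C hC hsize hcomp
  have h1 : 1 ≤ m ^ c := Nat.one_le_pow _ _ (by omega)
  have h0 : GateFn.const false ∈ basis (m ^ c) := h01 _ h1 (const_mem_monotoneBasis01 false)
  have hsim : ∀ g ∈ C.gates, CktSize (basis (m ^ c))
      (fun (z : Fin g.arity → Bool) (_ : Unit) => g.op z) (3 * m ^ c) := by
    intro g hg
    rcases hC g hg with hb | ⟨hmon, hfan⟩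
    · exact ((CktSize.gate (B := basis (m ^ c)) g.fn hb _root_.id).of_le (by omega)).congr
        fun _ _ => rfl
    · refine ((cktSize_of_monotone_gate g.fn hmon le_rfl).basis_mono (h01 _ h1)).of_le ?_
      have hb := monoBound_add_two_le g.fn.1
      have hfan' : 2 ^ g.fn.1 ≤ m ^ c := hfan
      omega
  obtain ⟨C', hC', hs', he'⟩ := Capture.Negative.Circuit.rebase h0 (3 * m ^ c) C hsim
  refine hm C' (hC'.mono (hmono (Nat.pow_le_pow_right (by omega) (by omega)))) ?_
    fun x => (he' x).trans (hcomp x)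
  calc C'.size ≤ 1 + 3 * m ^ c * C.size := hs'
    _ ≤ 1 + 3 * m ^ c * m ^ c := by gcongr
    _ ≤ m ^ (2 * c + 3) := one_add_three_mul_pow_le h2

/-- The constant `false` (arity 0) is a CONV gate of width 1 (`p = 1`, `q = 0`: the infeasible
constraint `0 ≤ -1`). [folklore] -/
theorem isConvGate_one_constFalse : IsConvGate 1 (GateFn.const false) := by
  refine ⟨1, 0, le_rfl, fun _ => 0, fun _ => -1, fun _ _ => 0, fun _ _ => le_rfl, fun v => ?_⟩
  constructor
  · intro h
    exact absurd h (by simp [GateFn.const])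
  · rintro ⟨Y, -, hY⟩
    have h0 := hY 0
    simp at h0
    linarith

/-- `{∧₂, ∨₂, 0, 1}` lies inside the convex sub-basis `{∧₂,∨₂} ∪ CONV_s` for `s ≥ 1`. [folklore] -/
theorem monotoneBasis01_subset_convFamily {s : ℕ} (hs : 1 ≤ s) :
    monotoneBasis01 ⊆ ({GateFn.and 2, GateFn.or 2} ∪ {g | IsConvGate s g} : Set GateFn) := by
  intro g hg
  simp only [monotoneBasis01, monotoneBasis, Set.mem_insert_iff, Set.mem_singleton_iff] at hg
  rcases hg with rfl | rfl | rfl | rfl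
  · exact Or.inr ((isConvGate_constTrue 0).mono (Nat.zero_le s))
  · exact Or.inr (isConvGate_one_constFalse.mono hs)
  · exact Or.inl (Or.inl rfl)
  · exact Or.inl (Or.inr rfl)

/-- `{∧₂, ∨₂, 0, 1}` lies inside the linear-algebra sub-basis `{∧₂,∨₂} ∪ PERM_s ∪ GRANK_s` for every `s`
(constants are GRANK gates of dimension 0: `isGRankGate_constTrue`, `isGRankGate_of_forall_eq_false`).
[folklore] -/
theorem monotoneBasis01_subset_linFamily (s : ℕ) :
    monotoneBasis01 ⊆
      ({GateFn.and 2, GateFn.or 2} ∪ {g | IsPermGate s g ∨ IsGRankGate s g} : Set GateFn) := by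
  intro g hg
  simp only [monotoneBasis01, monotoneBasis, Set.mem_insert_iff, Set.mem_singleton_iff] at hg
  rcases hg with rfl | rfl | rfl | rfl
  · exact Or.inr (Or.inr ((isGRankGate_constTrue 0).mono (Nat.zero_le s)))
  · exact Or.inr (Or.inr (isGRankGate_of_forall_eq_false fun _ => rfl))
  · exact Or.inl (Or.inl rfl)
  · exact Or.inl (Or.inr rfl)

/-- **The convex door alone beats every mixed circuit with narrow non-CONV gates.** From crux #2: for
its `δ` and every `c`, eventually no circuit with `≤ m^c` gates, each of which is `∧₂`, `∨₂`, a CONV gate of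
width `≤ m^c`, or ANY monotone gate `g` (PERM, GRANK, …) with `2^{fan-in g} ≤ m^c`, computes
`CLIQUE(m, ⌈m^δ⌉₊)`. [folklore] -/
theorem convexGateBlind_absorbs_narrow (hC : ConvexGateBlind) :
    ∃ δ : ℝ, 0 < δ ∧ δ < 1 / 2 ∧
      LowerBoundAtOver (fun s => ({GateFn.and 2, GateFn.or 2} ∪ {g | IsConvGate s g}) ∪
        {g | Monotone g.2 ∧ 2 ^ g.1 ≤ s}) (fun m => ⌈(m : ℝ) ^ δ⌉₊) := by
  obtain ⟨δ, h0, h1, hH⟩ := hC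
  refine ⟨δ, h0, h1, LowerBoundAtOver.absorb_narrow ?_ (fun s hs => monotoneBasis01_subset_convFamily hs) hH⟩
  -- the convex family is monotone in the size parameter (cf. `CliqueExtLowerBound.Negative.convFamily_monotone`)
  rintro s t hst g (hg | hg)
  · exact Or.inl hg
  · exact Or.inr (IsConvGate.mono hg hst)

/-- **The algebraic door alone beats every mixed circuit with narrow non-PERM/GRANK gates.** From crux #4:
for its `δ` and every `c`, eventually no circuit with `≤ m^c` gates, each of which is `∧₂`, `∨₂`, a PERM or
GRANK gate of size `≤ m^c`, or ANY monotone gate `g` (CONV, …) with `2^{fan-in g} ≤ m^c`, computes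
`CLIQUE(m, ⌈m^δ⌉₊)`. [folklore] -/
theorem linAlgGateBlind_absorbs_narrow (hL : LinAlgGateBlind) :
    ∃ δ : ℝ, 0 < δ ∧ δ < 1 / 2 ∧
      LowerBoundAtOver (fun s => ({GateFn.and 2, GateFn.or 2} ∪ {g | IsPermGate s g ∨ IsGRankGate s g}) ∪
        {g | Monotone g.2 ∧ 2 ^ g.1 ≤ s}) (fun m => ⌈(m : ℝ) ^ δ⌉₊) := by
  obtain ⟨δ, h0, h1, hH⟩ := linAlgGateBlind_iff.1 hL
  refine ⟨δ, h0, h1, LowerBoundAtOver.absorb_narrow ?_ (fun s _ => monotoneBasis01_subset_linFamily s) hH⟩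
  -- the linear-algebra family is monotone in the size parameter (cf. `…Negative.linFamily_monotone`)
  rintro s t hst g (hg | hg)
  · exact Or.inl hg
  · rcases hg with hg | hg
    · exact Or.inr (Or.inl (hg.mono hst))
    · exact Or.inr (Or.inr (hg.mono hst))

/-- **Glue item, narrow-algebraic case (from #2 alone).** For the `δ` of crux #2 and every `c`, eventually
no `B_{m^c}`-circuit with `≤ m^c` gates in which every gate that is NOT a CONV gate of width `≤ m^c` has
`2^{fan-in} ≤ m^c` (i.e. all PERM/GRANK gates proper have fan-in `≤ c·log₂ m`) computes `CLIQUE(m, ⌈m^δ⌉₊)`: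
such gates are monotone (`extGate_monotone`) and narrow, hence absorbed (`convexGateBlind_absorbs_narrow`).
So any synergy between the doors needs PERM/GRANK gates of fan-in `> c·log₂ m`. [folklore] -/
theorem convexGateBlind_mixed_of_narrow_algebraic (hC : ConvexGateBlind) :
    ∃ δ : ℝ, 0 < δ ∧ δ < 1 / 2 ∧ ∀ c : ℕ, ∀ᶠ m : ℕ in atTop,
      ∀ C : Circuit ((⊤ : SimpleGraph (Fin m)).edgeSet), C.IsOver (extGate (m ^ c)) →
        (∀ g ∈ C.gates, ¬ IsConvGate (m ^ c) g.fn → 2 ^ g.arity ≤ m ^ c) →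
        C.size ≤ m ^ c → ¬ C.Computes (cliqueFn m ⌈(m : ℝ) ^ δ⌉₊) := by
  obtain ⟨δ, h0, h1, hH⟩ := convexGateBlind_absorbs_narrow hC
  refine ⟨δ, h0, h1, fun c => ?_⟩
  filter_upwards [hH c] with m hm C hC hnarrow hsize
  refine hm C (fun g hg => ?_) hsize
  by_cases hconv : IsConvGate (m ^ c) g.fn
  · exact Or.inl (Or.inr hconv)
  · exact Or.inr ⟨extGate_monotone (hC g hg), hnarrow g hg hconv⟩

/-- **Glue item, narrow-convex case (from #4 alone).** For the `δ` of crux #4 and every `c`, eventually no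
`B_{m^c}`-circuit with `≤ m^c` gates in which every gate that is neither a PERM nor a GRANK gate of size
`≤ m^c` has `2^{fan-in} ≤ m^c` (i.e. all CONV gates proper have fan-in `≤ c·log₂ m`) computes
`CLIQUE(m, ⌈m^δ⌉₊)`. So any synergy between the doors needs CONV gates of fan-in `> c·log₂ m` as well.
[folklore] -/
theorem linAlgGateBlind_mixed_of_narrow_convex (hL : LinAlgGateBlind) :
    ∃ δ : ℝ, 0 < δ ∧ δ < 1 / 2 ∧ ∀ c : ℕ, ∀ᶠ m : ℕ in atTop,
      ∀ C : Circuit ((⊤ : SimpleGraph (Fin m)).edgeSet), C.IsOver (extGate (m ^ c)) →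
        (∀ g ∈ C.gates, ¬ (IsPermGate (m ^ c) g.fn ∨ IsGRankGate (m ^ c) g.fn) → 2 ^ g.arity ≤ m ^ c) →
        C.size ≤ m ^ c → ¬ C.Computes (cliqueFn m ⌈(m : ℝ) ^ δ⌉₊) := by
  obtain ⟨δ, h0, h1, hH⟩ := linAlgGateBlind_absorbs_narrow hL
  refine ⟨δ, h0, h1, fun c => ?_⟩
  filter_upwards [hH c] with m hm C hC hnarrow hsize
  refine hm C (fun g hg => ?_) hsize
  by_cases hlin : IsPermGate (m ^ c) g.fn ∨ IsGRankGate (m ^ c) g.fn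
  · exact Or.inl (Or.inr hlin)
  · exact Or.inr ⟨extGate_monotone (hC g hg), hnarrow g hg hlin⟩

end Narrow

end Summit.PneNP.PneNP.Theorems
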